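import Summits.FinalStateConjecture.FinalStateConjecture.Theses.ClusterCompleteness
import Summits.FinalStateConjecture.FinalStateConjecture.Theorems.ClusterCompletenessLinearToNonlinearCaptureStubScriOfEntry
import Summits.FinalStateConjecture.FinalStateConjecture.Theorems.StarvedNecksHonestFixedRadiusSettlingStubEntryBookkeeping
import Literature.Geometry.Lorentzian.HorizonLineage

/-!
# Crux `LinearToNonlinearCapture` (stmt-FinalStateConjecture-14526) — ROUTE-LEVEL SPLIT, v4 cut
# (crux-strategist `planner-cstrat-stmt-FinalStateConjecture-14526-s1-0`, gen 1, 2026-08-17)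

The decomposition this seat files with
`ledger route edit route-FinalStateConjecture-ClusterCompleteness --split LinearToNonlinearCapture
--into children-v4.json --glue …`: three children, typed over the Statement's cone (every constant
occurs already in the route file rev 21 or in `Literature.Geometry.Lorentzian.{Basic, Geodesic,
KerrConvergence, NullInfinity}` of its import cone), texts VERBATIM the registered stubs of the live
line `exterior-entry-capture` (skeleton v4, lead c13, tree `Lines/exterior_entry_capture.lean`
commit 98c1f6ed0a8f) where such a stub exists:

* `FarExteriorControl` (child C_far) = F″ `stub_farExteriorControl` verbatim — ONE
  Klainerman–Nicolò-type statement for the admissible class (COMPLETE ∧ FAR CHART with weighted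
  `C⁰/C¹` control ∧ ESCAPE ∧ FAR ENTRY). Recurrence-free, `N`-free, engine-free: SUMMIT-WIDE (every
  route to the Statement needs complete `𝓘⁺` for admissible data, hence this). Frontier item
  (c13 sweep: class `(s,q) = (3,1)`, every print needs `q ≥ 2`).
* `ScriOfSettledFarControlled` (child C_scri) = "F″'s conclusion for `𝒟` → `𝒟` settles (re-typed
  matrix) → complete `𝓘⁺`". Recurrence-free, `N`-free, engine-free, summit-wide; classical
  Lorentzian geometry. Its only open content is the entry-band lemma G′
  (`scriOfSettledFarControlled_of_entryBandGlue` below: G′ verbatim ⇒ C_scri, sorry-free, using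
  the LANDED S_C `Theorems.stub_scriOfEntry`, p139865).
* `AnchoredRecurrenceSettles` (child C_cap) = S_D `stub_anchoredRecurrenceSettles` verbatim — the
  capture core (X minus its `𝓘⁺` conjunct; necessary: `anchoredRecurrenceSettles_of_target`).

GLUE `linearToNonlinearCapture_of_subs : C_far → C_scri → C_cap → LinearToNonlinearCapture`
(ten lines of logic; the conclusion is the route decl BY NAME) — this is the theorem the gate's
generated glue item asks for; `linearToNonlinearCapture_of_subs_inlined` states it with the three
children INLINED verbatim (the shape the glue item δ-unfolds to). Read-backs: `target_of_subs`
(the three children give X itself, engine-free), `anchoredRecurrenceSettles_of_target` (X ⇒ C_cap),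
`scriOfSettled_of_far_of_scri` (C_far ∧ C_scri ⇒ the summit-wide "settled ⇒ complete `𝓘⁺`").
Farm: `lean check` rc 0, 0 sorries (this seat, 2026-08-17).
-/

namespace Summit.FinalStateConjecture.FinalStateConjecture.Cruxes.LinearToNonlinearCapture.SplitV4

set_option linter.dupNamespace false
set_option maxSynthPendingDepth 3

open scoped BigOperators Topology Manifold ENNReal ContDiff
open Filter Set Function TopologicalSpace Bundle MeasureTheory
open Literature.Geometry.Lorentzian
open Summit.FinalStateConjecture.FinalStateConjecture.Theses.ClusterCompleteness
open Summit.FinalStateConjecture.FinalStateConjecture.Theorems.StarvedNecks.OneOverDelta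

/-- Child C_far `FarExteriorControl` — verbatim F″ `stub_farExteriorControl` (skeleton v4). -/
def FarExteriorControl : Prop :=
    ∀ (X : Type) [TopologicalSpace X] [ChartedSpace E3 X] [IsManifold (𝓡 3) ∞ X] [T2Space X]
    [SecondCountableTopology X] [ConnectedSpace X], ∀ D ∈ admissibleVacuumData X, ∀ 𝒟 :
    VacuumCauchyDevelopment D, 𝒟.IsMaximal → ∀ [𝒟.metric.HasLeviCivita], ∃ (K : Set X) (R C : ℝ) (U
    : Opens E4) (Φ : U → 𝒟.carrier), IsCompact K ∧ (∀ (p : X) (γ : ℝ → 𝒟.carrier) (dom : Set ℝ),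
    𝒟.metric.IsNormalisedNullRayFrom 𝒟.timeOrientation 𝒟.embed 𝒟.normal p γ dom → (∀ t ∈ dom, 0 ≤ t
    → γ t ∉ 𝒟.metric.causalFuture 𝒟.timeOrientation (𝒟.embed '' K)) → ¬ BddAbove dom) ∧ (ContMDiff
    𝓘(ℝ, E4) (𝓡 4) ∞ Φ ∧ Topology.IsOpenEmbedding Φ ∧ {x : E4 | 0 < x 0 ∧ x 0 + R < E4.spatialNorm
    x} ⊆ (U : Set E4) ∧ 𝒟.metric.causalFuture 𝒟.timeOrientation (range 𝒟.embed) \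
    𝒟.metric.causalFuture 𝒟.timeOrientation (𝒟.embed '' K) ⊆ Φ '' {x : U | 0 ≤ x.1 0 ∧ x.1 0 + R <
    E4.spatialNorm x.1} ∧ (∀ x : U, 𝒟.timeOrientation.IsFutureDirected (mfderiv 𝓘(ℝ, E4) (𝓡 4) Φ x
    (E4.basisVector 0))) ∧ (∀ x : U, ‖𝒟.toSpacetime.deviation (Minkowski.backgroundOn U) Φ x‖ ≤ C *
    Real.log (2 + E4.spatialNorm x.1) / (1 + E4.spatialNorm x.1)) ∧ (∀ x : U, ∀ v : E4, ‖fderiv ℝ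
    (𝒟.toSpacetime.deviationExtend (Minkowski.backgroundOn U) Φ) x.1 v‖ ≤ C * Real.log (2 +
    E4.spatialNorm x.1) / ((1 + E4.spatialNorm x.1) * (1 + |x.1 0 - E4.spatialNorm x.1|)) * ‖v‖)) ∧
    (∀ K' : Set X, IsCompact K' → ∃ K'' : Set X, IsCompact K'' ∧ ∀ q ∈ 𝒟.metric.causalFuture
    𝒟.timeOrientation (range 𝒟.embed), q ∉ 𝒟.metric.causalFuture 𝒟.timeOrientation (𝒟.embed '' K'')
    → ∃ (p : X) (γ : ℝ → 𝒟.carrier) (dom : Set ℝ) (t : ℝ), 𝒟.metric.IsNormalisedNullRayFrom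
    𝒟.timeOrientation 𝒟.embed 𝒟.normal p γ dom ∧ t ∈ dom ∧ 0 ≤ t ∧ γ t = q ∧ ∀ t' ∈ dom, 0 ≤ t' → γ
    t' ∉ 𝒟.metric.causalFuture 𝒟.timeOrientation (𝒟.embed '' K')) ∧ ∀ K' : Set X, IsCompact K' → ∃
    Bs : Set X, IsCompact Bs ∧ ∀ B : Set X, IsCompact B → Bs ⊆ B → ∃ R' : ℝ, ∀ t₁ : ℝ, ∃ B₁ : Set X,
    IsCompact B₁ ∧ ∀ p ∉ B₁, ∀ (γ : ℝ → 𝒟.carrier) (dom : Set ℝ), 𝒟.metric.IsNormalisedNullRayFrom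
    𝒟.timeOrientation 𝒟.embed 𝒟.normal p γ dom → (∃ t ∈ dom, 0 ≤ t ∧ γ t ∈ 𝒟.metric.causalFuture
    𝒟.timeOrientation (𝒟.embed '' B)) → ∃ (s₀ : ℝ) (x : U) (w : E4), s₀ ∈ dom ∧ 0 ≤ s₀ ∧ γ s₀ ∈
    𝒟.metric.causalFuture 𝒟.timeOrientation (𝒟.embed '' B) ∧ γ s₀ ∉ 𝒟.metric.causalFuture
    𝒟.timeOrientation (𝒟.embed '' K') ∧ γ s₀ = Φ x ∧ t₁ ≤ x.1 0 ∧ x.1 0 + R < E4.spatialNorm x.1 ∧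
    E4.spatialNorm x.1 ≤ x.1 0 + R' ∧ velocity (𝓡 4) γ s₀ = mfderiv 𝓘(ℝ, E4) (𝓡 4) Φ x w ∧ 1 / 2 ≤ w
    0 ∧ w 0 ≤ 2

/-- Child C_scri `ScriOfSettledFarControlled` — F″'s conclusion for `𝒟` → settles → complete `𝓘⁺`. -/
def ScriOfSettledFarControlled : Prop :=
    ∀ (X : Type) [TopologicalSpace X] [ChartedSpace E3 X] [IsManifold (𝓡 3) ∞ X] [T2Space X]
    [SecondCountableTopology X] [ConnectedSpace X], ∀ D ∈ admissibleVacuumData X, ∀ 𝒟 :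
    VacuumCauchyDevelopment D, 𝒟.IsMaximal → (∀ [𝒟.metric.HasLeviCivita], ∃ (K : Set X) (R C : ℝ) (U
    : Opens E4) (Φ : U → 𝒟.carrier), IsCompact K ∧ (∀ (p : X) (γ : ℝ → 𝒟.carrier) (dom : Set ℝ),
    𝒟.metric.IsNormalisedNullRayFrom 𝒟.timeOrientation 𝒟.embed 𝒟.normal p γ dom → (∀ t ∈ dom, 0 ≤ t
    → γ t ∉ 𝒟.metric.causalFuture 𝒟.timeOrientation (𝒟.embed '' K)) → ¬ BddAbove dom) ∧ (ContMDiff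
    𝓘(ℝ, E4) (𝓡 4) ∞ Φ ∧ Topology.IsOpenEmbedding Φ ∧ {x : E4 | 0 < x 0 ∧ x 0 + R < E4.spatialNorm
    x} ⊆ (U : Set E4) ∧ 𝒟.metric.causalFuture 𝒟.timeOrientation (range 𝒟.embed) \
    𝒟.metric.causalFuture 𝒟.timeOrientation (𝒟.embed '' K) ⊆ Φ '' {x : U | 0 ≤ x.1 0 ∧ x.1 0 + R <
    E4.spatialNorm x.1} ∧ (∀ x : U, 𝒟.timeOrientation.IsFutureDirected (mfderiv 𝓘(ℝ, E4) (𝓡 4) Φ x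
    (E4.basisVector 0))) ∧ (∀ x : U, ‖𝒟.toSpacetime.deviation (Minkowski.backgroundOn U) Φ x‖ ≤ C *
    Real.log (2 + E4.spatialNorm x.1) / (1 + E4.spatialNorm x.1)) ∧ (∀ x : U, ∀ v : E4, ‖fderiv ℝ
    (𝒟.toSpacetime.deviationExtend (Minkowski.backgroundOn U) Φ) x.1 v‖ ≤ C * Real.log (2 +
    E4.spatialNorm x.1) / ((1 + E4.spatialNorm x.1) * (1 + |x.1 0 - E4.spatialNorm x.1|)) * ‖v‖)) ∧
    (∀ K' : Set X, IsCompact K' → ∃ K'' : Set X, IsCompact K'' ∧ ∀ q ∈ 𝒟.metric.causalFuture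
    𝒟.timeOrientation (range 𝒟.embed), q ∉ 𝒟.metric.causalFuture 𝒟.timeOrientation (𝒟.embed '' K'')
    → ∃ (p : X) (γ : ℝ → 𝒟.carrier) (dom : Set ℝ) (t : ℝ), 𝒟.metric.IsNormalisedNullRayFrom
    𝒟.timeOrientation 𝒟.embed 𝒟.normal p γ dom ∧ t ∈ dom ∧ 0 ≤ t ∧ γ t = q ∧ ∀ t' ∈ dom, 0 ≤ t' → γ
    t' ∉ 𝒟.metric.causalFuture 𝒟.timeOrientation (𝒟.embed '' K')) ∧ ∀ K' : Set X, IsCompact K' → ∃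
    Bs : Set X, IsCompact Bs ∧ ∀ B : Set X, IsCompact B → Bs ⊆ B → ∃ R' : ℝ, ∀ t₁ : ℝ, ∃ B₁ : Set X,
    IsCompact B₁ ∧ ∀ p ∉ B₁, ∀ (γ : ℝ → 𝒟.carrier) (dom : Set ℝ), 𝒟.metric.IsNormalisedNullRayFrom
    𝒟.timeOrientation 𝒟.embed 𝒟.normal p γ dom → (∃ t ∈ dom, 0 ≤ t ∧ γ t ∈ 𝒟.metric.causalFuture
    𝒟.timeOrientation (𝒟.embed '' B)) → ∃ (s₀ : ℝ) (x : U) (w : E4), s₀ ∈ dom ∧ 0 ≤ s₀ ∧ γ s₀ ∈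
    𝒟.metric.causalFuture 𝒟.timeOrientation (𝒟.embed '' B) ∧ γ s₀ ∉ 𝒟.metric.causalFuture
    𝒟.timeOrientation (𝒟.embed '' K') ∧ γ s₀ = Φ x ∧ t₁ ≤ x.1 0 ∧ x.1 0 + R < E4.spatialNorm x.1 ∧
    E4.spatialNorm x.1 ≤ x.1 0 + R' ∧ velocity (𝓡 4) γ s₀ = mfderiv 𝓘(ℝ, E4) (𝓡 4) Φ x w ∧ 1 / 2 ≤ w
    0 ∧ w 0 ≤ 2) → (∃ (O : Set 𝒟.carrier) (d : FinalStateDecomposition 𝒟.toSpacetime O 2), (∀ i,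
    Kerr.IsSubextremal (d.mass i) (d.spin i)) ∧ O = Summit.FinalStateConjecture.exteriorOf
    𝒟.toCauchyDevelopment d.charted ∧ Summit.FinalStateConjecture.RaysStayInClosure
    𝒟.toCauchyDevelopment O ∧ Summit.FinalStateConjecture.HasExhaustiveCharts d ∧
    Summit.FinalStateConjecture.IsFutureOriented d) →
    Summit.FinalStateConjecture.HasCompleteNullInfinity 𝒟.toCauchyDevelopment

/-- Child C_cap `AnchoredRecurrenceSettles` — verbatim S_D `stub_anchoredRecurrenceSettles`. -/
def AnchoredRecurrenceSettles : Prop :=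
    ∃ k : ℕ, ∀ (X : Type) [TopologicalSpace X] [ChartedSpace E3 X] [IsManifold (𝓡 3) ∞ X] [T2Space
    X] [SecondCountableTopology X] [ConnectedSpace X], ∀ D ∈ admissibleVacuumData X, ∀ 𝒟 :
    VacuumCauchyDevelopment D, 𝒟.IsMaximal → (∃ (O : Set 𝒟.carrier) (N : ℕ) (M a : Fin N → ℝ) (mo :
    Fin N → lorentzGroup × E4) (τ₀ : ℝ) (Ψ : ∀ i, boostedKerrExterior (mo i).1 (mo i).2 (M i) (a i)
    → 𝒟.carrier) (ρ R : Fin N → ℝ → ℝ) (U₀ : Opens E4) (Ψ₀ : U₀ → 𝒟.carrier), (∀ i,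
    Kerr.IsSubextremal (M i) (a i)) ∧ (∀ i, 𝒟.toSpacetime.IsLateChart (boostedKerrBackground (mo
    i).1 (mo i).2 (M i) (a i)) O τ₀ (Ψ i)) ∧ 𝒟.toSpacetime.IsLateChart (Minkowski.backgroundOn U₀) O
    τ₀ Ψ₀ ∧ (∀ i, Tendsto (fun t ↦ ρ i t / t) atTop (𝓝 0)) ∧ (∀ i, Tendsto (R i) atTop atTop ∧ ∀ τ,
    max (Kerr.rPlus (M i) (a i)) 0 + 1 ≤ R i τ) ∧ {x : E4 | τ₀ < x 0 ∧ ∀ i, ρ i (x 0) < Kerr.radius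
    (a i) (poincareInv (mo i).1 (mo i).2 x)} ⊆ (U₀ : Set E4) ∧ (∀ R' : ℝ, ∃ τ₁ : ℝ, Pairwise
    (Function.onFun Disjoint fun i ↦ Ψ i '' (boostedKerrBackground (mo i).1 (mo i).2 (M i) (a
    i)).truncLateRegion τ₁ R')) ∧ O = Summit.FinalStateConjecture.exteriorOf 𝒟.toCauchyDevelopment
    ((⋃ i, Ψ i '' (boostedKerrBackground (mo i).1 (mo i).2 (M i) (a i)).lateRegion τ₀) ∪ Ψ₀ ''
    (Minkowski.backgroundOn U₀).lateRegion τ₀) ∧ Summit.FinalStateConjecture.RaysStayInClosure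
    𝒟.toCauchyDevelopment O ∧ (∀ τ₁ : ℝ, τ₀ < τ₁ → O \ (Ψ₀ '' (Minkowski.backgroundOn U₀).lateRegion
    τ₁ ∪ ⋃ i, Ψ i '' {x | τ₁ < (boostedKerrBackground (mo i).1 (mo i).2 (M i) (a i)).time x.1 ∧
    (boostedKerrBackground (mo i).1 (mo i).2 (M i) (a i)).radius x.1 ≤ R i ((boostedKerrBackground
    (mo i).1 (mo i).2 (M i) (a i)).time x.1)}) ⊆ 𝒟.metric.causalPast 𝒟.timeOrientation (Ψ₀ ''
    (Minkowski.backgroundOn U₀).timeSlab τ₁ ∪ ⋃ i, Ψ i '' (boostedKerrBackground (mo i).1 (mo i).2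
    (M i) (a i)).truncTimeSlab (R i τ₁) τ₁)) ∧ ((∀ i, Summit.FinalStateConjecture.IsOrthochronous
    (mo i).1) ∧ ∀ τ : ℝ, τ₀ < τ → ∀ x ∈ (Minkowski.backgroundOn U₀).timeSlab τ,
    𝒟.toSpacetime.timeOrientation.IsFutureDirected (mfderiv 𝓘(ℝ, E4) (𝓡 4) Ψ₀ x (E4.basisVector 0)))
    ∧ (∀ τ : ℝ, τ₀ < τ → 𝒟.toSpacetime.deviationCk (Minkowski.backgroundOn U₀) Ψ₀ 0 τ ≤
    ENNReal.ofReal (1 / 4) ∧ ∀ i, 𝒟.toSpacetime.truncDeviationCk (boostedKerrBackground (mo i).1 (mo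
    i).2 (M i) (a i)) (Ψ i) 0 (R i τ) τ ≤ ENNReal.ofReal (1 / 4)) ∧ ∀ R' : ℝ, ∀ ε : ℝ, 0 < ε → ∃ᶠ τ
    in atTop, 𝒟.toSpacetime.deviationCk (Minkowski.backgroundOn U₀) Ψ₀ k τ ≤ ENNReal.ofReal ε ∧ ∀ i,
    𝒟.toSpacetime.truncDeviationCk (boostedKerrBackground (mo i).1 (mo i).2 (M i) (a i)) (Ψ i) k R'
    τ ≤ ENNReal.ofReal ε ∧ ∀ x ∈ (boostedKerrBackground (mo i).1 (mo i).2 (M i) (a i)).truncTimeSlab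
    R' τ, 𝒟.toSpacetime.timeOrientation.IsFutureDirected (mfderiv 𝓘(ℝ, E4) (𝓡 4) (Ψ i) x (((mo i).1
    : E4 ≃L[ℝ] E4) (Kerr.timeVector (M i) (a i) (poincareInv (mo i).1 (mo i).2 (x : E4)))))) → ∃ (O
    : Set 𝒟.carrier) (d : FinalStateDecomposition 𝒟.toSpacetime O 2), (∀ i, Kerr.IsSubextremal
    (d.mass i) (d.spin i)) ∧ O = Summit.FinalStateConjecture.exteriorOf 𝒟.toCauchyDevelopment
    d.charted ∧ Summit.FinalStateConjecture.RaysStayInClosure 𝒟.toCauchyDevelopment O ∧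
    Summit.FinalStateConjecture.HasExhaustiveCharts d ∧ Summit.FinalStateConjecture.IsFutureOriented
    d

/-- The entry-band lemma G′ of the live line (verbatim `stub_entryBandGlue_eventual`, skeleton v4),
as a named `Prop` (NOT a child: it is line-level content of C_scri). -/
def EntryBandGlueEventual : Prop :=
    ∀ (X : Type) [TopologicalSpace X] [ChartedSpace E3 X] [IsManifold (𝓡 3) ∞ X] [T2Space X]
    [SecondCountableTopology X] [ConnectedSpace X], ∀ D ∈ admissibleVacuumData X, ∀ 𝒟 :
    VacuumCauchyDevelopment D, 𝒟.IsMaximal → ∀ (O : Set 𝒟.carrier) (d : FinalStateDecomposition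
    𝒟.toSpacetime O 2), O = Summit.FinalStateConjecture.exteriorOf 𝒟.toCauchyDevelopment d.charted →
    Summit.FinalStateConjecture.HasExhaustiveCharts d → Summit.FinalStateConjecture.IsFutureOriented
    d → ∀ (K : Set X) (R C : ℝ) (U : Opens E4) (Φ : U → 𝒟.carrier), (ContMDiff 𝓘(ℝ, E4) (𝓡 4) ∞ Φ ∧
    Topology.IsOpenEmbedding Φ ∧ {x : E4 | 0 < x 0 ∧ x 0 + R < E4.spatialNorm x} ⊆ (U : Set E4) ∧
    𝒟.metric.causalFuture 𝒟.timeOrientation (range 𝒟.embed) \ 𝒟.metric.causalFuture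
    𝒟.timeOrientation (𝒟.embed '' K) ⊆ Φ '' {x : U | 0 ≤ x.1 0 ∧ x.1 0 + R < E4.spatialNorm x.1} ∧
    (∀ x : U, 𝒟.timeOrientation.IsFutureDirected (mfderiv 𝓘(ℝ, E4) (𝓡 4) Φ x (E4.basisVector 0))) ∧
    (∀ x : U, ‖𝒟.toSpacetime.deviation (Minkowski.backgroundOn U) Φ x‖ ≤ C * Real.log (2 +
    E4.spatialNorm x.1) / (1 + E4.spatialNorm x.1)) ∧ (∀ x : U, ‖fderiv ℝ
    (𝒟.toSpacetime.deviationExtend (Minkowski.backgroundOn U) Φ) x.1‖ ≤ C * Real.log (2 +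
    E4.spatialNorm x.1) / ((1 + E4.spatialNorm x.1) * (1 + |x.1 0 - E4.spatialNorm x.1|)))) → ∀
    [𝒟.metric.HasLeviCivita], ∃ (O' : Set 𝒟.carrier) (d' : FinalStateDecomposition 𝒟.toSpacetime O'
    2) (L : ℝ), 0 < L ∧ ∀ R' τ T : ℝ, ∃ t₁ : ℝ, ∀ (p : X) (γ : ℝ → 𝒟.carrier) (dom : Set ℝ) (s₀ : ℝ)
    (x : U) (w : E4), 𝒟.metric.IsNormalisedNullRayFrom 𝒟.timeOrientation 𝒟.embed 𝒟.normal p γ dom →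
    s₀ ∈ dom → 0 ≤ s₀ → γ s₀ = Φ x → t₁ ≤ x.1 0 → x.1 0 + R < E4.spatialNorm x.1 → E4.spatialNorm
    x.1 ≤ x.1 0 + R' → Φ x ∈ closure O → velocity (𝓡 4) γ s₀ = mfderiv 𝓘(ℝ, E4) (𝓡 4) Φ x w → w 0 ≤
    2 → ¬ BddAbove dom ∨ ∃ (s : ℝ) (y : d'.flatDomain) (w' : E4), s ∈ dom ∧ s₀ ≤ s ∧ γ s ∈
    𝒟.metric.causalFuture 𝒟.timeOrientation {γ s₀} ∧ γ s = d'.flatChart y ∧ d'.τ₀ < y.1 0 ∧ τ ≤ y.1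
    0 ∧ {z : E4 | y.1 0 ≤ z 0 ∧ z 0 ≤ y.1 0 + T ∧ ‖E4.spatial z - E4.spatial y.1‖ ≤ 2 * (z 0 - y.1
    0) + 1} ⊆ (d'.flatDomain : Set E4) ∧ velocity (𝓡 4) γ s = mfderiv 𝓘(ℝ, E4) (𝓡 4) d'.flatChart y
    w' ∧ 0 < w' 0 ∧ w' 0 ≤ L

/-- F″ of the live line verbatim (`stub_farExteriorControl`, skeleton v4; operator-norm form of the
`C¹` clause), as a named `Prop` (NOT a child: the child C_far states the `C¹` clause APPLIED to
vectors, `‖∂(Φ^*g − η)(x) v‖ ≤ C·w₁(x)·‖v‖`, because the operator norm of the nested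
`E4 →L[ℝ] E4 →L[ℝ] E4 →L[ℝ] ℝ` needs `maxSynthPendingDepth 3`, which the gate-rendered route file
does not set — checked: the verbatim form fails to elaborate in the route file's context, the
applied form elaborates). -/
def FarExteriorControlStub : Prop :=
    ∀ (X : Type) [TopologicalSpace X] [ChartedSpace E3 X] [IsManifold (𝓡 3) ∞ X] [T2Space X]
    [SecondCountableTopology X] [ConnectedSpace X], ∀ D ∈ admissibleVacuumData X, ∀ 𝒟 :
    VacuumCauchyDevelopment D, 𝒟.IsMaximal → ∀ [𝒟.metric.HasLeviCivita], ∃ (K : Set X) (R C : ℝ) (U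
    : Opens E4) (Φ : U → 𝒟.carrier), IsCompact K ∧ (∀ (p : X) (γ : ℝ → 𝒟.carrier) (dom : Set ℝ),
    𝒟.metric.IsNormalisedNullRayFrom 𝒟.timeOrientation 𝒟.embed 𝒟.normal p γ dom → (∀ t ∈ dom, 0 ≤ t
    → γ t ∉ 𝒟.metric.causalFuture 𝒟.timeOrientation (𝒟.embed '' K)) → ¬ BddAbove dom) ∧ (ContMDiff
    𝓘(ℝ, E4) (𝓡 4) ∞ Φ ∧ Topology.IsOpenEmbedding Φ ∧ {x : E4 | 0 < x 0 ∧ x 0 + R < E4.spatialNorm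
    x} ⊆ (U : Set E4) ∧ 𝒟.metric.causalFuture 𝒟.timeOrientation (range 𝒟.embed) \
    𝒟.metric.causalFuture 𝒟.timeOrientation (𝒟.embed '' K) ⊆ Φ '' {x : U | 0 ≤ x.1 0 ∧ x.1 0 + R <
    E4.spatialNorm x.1} ∧ (∀ x : U, 𝒟.timeOrientation.IsFutureDirected (mfderiv 𝓘(ℝ, E4) (𝓡 4) Φ x
    (E4.basisVector 0))) ∧ (∀ x : U, ‖𝒟.toSpacetime.deviation (Minkowski.backgroundOn U) Φ x‖ ≤ C *
    Real.log (2 + E4.spatialNorm x.1) / (1 + E4.spatialNorm x.1)) ∧ (∀ x : U, ‖fderiv ℝ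
    (𝒟.toSpacetime.deviationExtend (Minkowski.backgroundOn U) Φ) x.1‖ ≤ C * Real.log (2 +
    E4.spatialNorm x.1) / ((1 + E4.spatialNorm x.1) * (1 + |x.1 0 - E4.spatialNorm x.1|)))) ∧ (∀ K'
    : Set X, IsCompact K' → ∃ K'' : Set X, IsCompact K'' ∧ ∀ q ∈ 𝒟.metric.causalFuture
    𝒟.timeOrientation (range 𝒟.embed), q ∉ 𝒟.metric.causalFuture 𝒟.timeOrientation (𝒟.embed '' K'')
    → ∃ (p : X) (γ : ℝ → 𝒟.carrier) (dom : Set ℝ) (t : ℝ), 𝒟.metric.IsNormalisedNullRayFrom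
    𝒟.timeOrientation 𝒟.embed 𝒟.normal p γ dom ∧ t ∈ dom ∧ 0 ≤ t ∧ γ t = q ∧ ∀ t' ∈ dom, 0 ≤ t' → γ
    t' ∉ 𝒟.metric.causalFuture 𝒟.timeOrientation (𝒟.embed '' K')) ∧ ∀ K' : Set X, IsCompact K' → ∃
    Bs : Set X, IsCompact Bs ∧ ∀ B : Set X, IsCompact B → Bs ⊆ B → ∃ R' : ℝ, ∀ t₁ : ℝ, ∃ B₁ : Set X,
    IsCompact B₁ ∧ ∀ p ∉ B₁, ∀ (γ : ℝ → 𝒟.carrier) (dom : Set ℝ), 𝒟.metric.IsNormalisedNullRayFrom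
    𝒟.timeOrientation 𝒟.embed 𝒟.normal p γ dom → (∃ t ∈ dom, 0 ≤ t ∧ γ t ∈ 𝒟.metric.causalFuture
    𝒟.timeOrientation (𝒟.embed '' B)) → ∃ (s₀ : ℝ) (x : U) (w : E4), s₀ ∈ dom ∧ 0 ≤ s₀ ∧ γ s₀ ∈
    𝒟.metric.causalFuture 𝒟.timeOrientation (𝒟.embed '' B) ∧ γ s₀ ∉ 𝒟.metric.causalFuture
    𝒟.timeOrientation (𝒟.embed '' K') ∧ γ s₀ = Φ x ∧ t₁ ≤ x.1 0 ∧ x.1 0 + R < E4.spatialNorm x.1 ∧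
    E4.spatialNorm x.1 ≤ x.1 0 + R' ∧ velocity (𝓡 4) γ s₀ = mfderiv 𝓘(ℝ, E4) (𝓡 4) Φ x w ∧ 1 / 2 ≤ w
    0 ∧ w 0 ≤ 2

/-- **Bridge (line ↦ child).** The live line's F″ (operator-norm form) gives the child C_far
(applied form): `‖f v‖ ≤ ‖f‖·‖v‖`. -/
theorem farExteriorControl_of_stub (h : FarExteriorControlStub) : FarExteriorControl := by
  intro X _ _ _ _ _ _ D hD 𝒟 hmax _
  obtain ⟨K, R, C, U, Φ, hK, hcomplete, ⟨h1, h2, h3, h4, h5, h6, h7⟩, hesc, hent⟩ := h X D hD 𝒟 hmax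
  exact ⟨K, R, C, U, Φ, hK, hcomplete, ⟨h1, h2, h3, h4, h5, h6, fun x v ↦
    (fderiv ℝ (𝒟.toSpacetime.deviationExtend (Minkowski.backgroundOn U) Φ) x.1).le_of_opNorm_le
      (h7 x) v⟩, hesc, hent⟩

/-- **GLUE (route-edit shape).** The three children prove the crux BY NAME: discard the inert
engine binder; `k` from C_cap; for a development satisfying X's hypothesis at order `k`, C_cap
gives the settle matrix and C_scri, fed with C_far's far control, complete `𝓘⁺`. -/
theorem linearToNonlinearCapture_of_subs (hfar : FarExteriorControl)
    (hscri : ScriOfSettledFarControlled) (hcap : AnchoredRecurrenceSettles) :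
    Summit.FinalStateConjecture.FinalStateConjecture.Theses.ClusterCompleteness.LinearToNonlinearCapture := by
  intro _
  obtain ⟨k, hk⟩ := hcap
  refine ⟨k, ?_⟩
  intro X _ _ _ _ _ _ D hD 𝒟 hmax hhyp
  have hs := hk X D hD 𝒟 hmax hhyp
  exact ⟨hscri X D hD 𝒟 hmax (hfar X D hD 𝒟 hmax) hs, hs⟩

/-- The same glue with the three children INLINED verbatim (δ-unfolds to the generated glue item). -/
theorem linearToNonlinearCapture_of_subs_inlined :
    (∀ (X : Type) [TopologicalSpace X] [ChartedSpace E3 X] [IsManifold (𝓡 3) ∞ X] [T2Space X]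
      [SecondCountableTopology X] [ConnectedSpace X], ∀ D ∈ admissibleVacuumData X, ∀ 𝒟 :
      VacuumCauchyDevelopment D, 𝒟.IsMaximal → ∀ [𝒟.metric.HasLeviCivita], ∃ (K : Set X) (R C : ℝ)
      (U : Opens E4) (Φ : U → 𝒟.carrier), IsCompact K ∧ (∀ (p : X) (γ : ℝ → 𝒟.carrier) (dom : Set
      ℝ), 𝒟.metric.IsNormalisedNullRayFrom 𝒟.timeOrientation 𝒟.embed 𝒟.normal p γ dom → (∀ t ∈ dom,
      0 ≤ t → γ t ∉ 𝒟.metric.causalFuture 𝒟.timeOrientation (𝒟.embed '' K)) → ¬ BddAbove dom) ∧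
      (ContMDiff 𝓘(ℝ, E4) (𝓡 4) ∞ Φ ∧ Topology.IsOpenEmbedding Φ ∧ {x : E4 | 0 < x 0 ∧ x 0 + R <
      E4.spatialNorm x} ⊆ (U : Set E4) ∧ 𝒟.metric.causalFuture 𝒟.timeOrientation (range 𝒟.embed) \
      𝒟.metric.causalFuture 𝒟.timeOrientation (𝒟.embed '' K) ⊆ Φ '' {x : U | 0 ≤ x.1 0 ∧ x.1 0 + R <
      E4.spatialNorm x.1} ∧ (∀ x : U, 𝒟.timeOrientation.IsFutureDirected (mfderiv 𝓘(ℝ, E4) (𝓡 4) Φ x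
      (E4.basisVector 0))) ∧ (∀ x : U, ‖𝒟.toSpacetime.deviation (Minkowski.backgroundOn U) Φ x‖ ≤ C
      * Real.log (2 + E4.spatialNorm x.1) / (1 + E4.spatialNorm x.1)) ∧ (∀ x : U, ∀ v : E4, ‖fderiv
      ℝ (𝒟.toSpacetime.deviationExtend (Minkowski.backgroundOn U) Φ) x.1 v‖ ≤ C * Real.log (2 +
      E4.spatialNorm x.1) / ((1 + E4.spatialNorm x.1) * (1 + |x.1 0 - E4.spatialNorm x.1|)) * ‖v‖))
      ∧ (∀ K' : Set X, IsCompact K' → ∃ K'' : Set X, IsCompact K'' ∧ ∀ q ∈ 𝒟.metric.causalFuture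
      𝒟.timeOrientation (range 𝒟.embed), q ∉ 𝒟.metric.causalFuture 𝒟.timeOrientation (𝒟.embed ''
      K'') → ∃ (p : X) (γ : ℝ → 𝒟.carrier) (dom : Set ℝ) (t : ℝ), 𝒟.metric.IsNormalisedNullRayFrom
      𝒟.timeOrientation 𝒟.embed 𝒟.normal p γ dom ∧ t ∈ dom ∧ 0 ≤ t ∧ γ t = q ∧ ∀ t' ∈ dom, 0 ≤ t' →
      γ t' ∉ 𝒟.metric.causalFuture 𝒟.timeOrientation (𝒟.embed '' K')) ∧ ∀ K' : Set X, IsCompact K' →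
      ∃ Bs : Set X, IsCompact Bs ∧ ∀ B : Set X, IsCompact B → Bs ⊆ B → ∃ R' : ℝ, ∀ t₁ : ℝ, ∃ B₁ :
      Set X, IsCompact B₁ ∧ ∀ p ∉ B₁, ∀ (γ : ℝ → 𝒟.carrier) (dom : Set ℝ),
      𝒟.metric.IsNormalisedNullRayFrom 𝒟.timeOrientation 𝒟.embed 𝒟.normal p γ dom → (∃ t ∈ dom, 0 ≤
      t ∧ γ t ∈ 𝒟.metric.causalFuture 𝒟.timeOrientation (𝒟.embed '' B)) → ∃ (s₀ : ℝ) (x : U) (w :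
      E4), s₀ ∈ dom ∧ 0 ≤ s₀ ∧ γ s₀ ∈ 𝒟.metric.causalFuture 𝒟.timeOrientation (𝒟.embed '' B) ∧ γ s₀
      ∉ 𝒟.metric.causalFuture 𝒟.timeOrientation (𝒟.embed '' K') ∧ γ s₀ = Φ x ∧ t₁ ≤ x.1 0 ∧ x.1 0 +
      R < E4.spatialNorm x.1 ∧ E4.spatialNorm x.1 ≤ x.1 0 + R' ∧ velocity (𝓡 4) γ s₀ = mfderiv 𝓘(ℝ,
      E4) (𝓡 4) Φ x w ∧ 1 / 2 ≤ w 0 ∧ w 0 ≤ 2) →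
    (∀ (X : Type) [TopologicalSpace X] [ChartedSpace E3 X] [IsManifold (𝓡 3) ∞ X] [T2Space X]
      [SecondCountableTopology X] [ConnectedSpace X], ∀ D ∈ admissibleVacuumData X, ∀ 𝒟 :
      VacuumCauchyDevelopment D, 𝒟.IsMaximal → (∀ [𝒟.metric.HasLeviCivita], ∃ (K : Set X) (R C : ℝ)
      (U : Opens E4) (Φ : U → 𝒟.carrier), IsCompact K ∧ (∀ (p : X) (γ : ℝ → 𝒟.carrier) (dom : Set
      ℝ), 𝒟.metric.IsNormalisedNullRayFrom 𝒟.timeOrientation 𝒟.embed 𝒟.normal p γ dom → (∀ t ∈ dom,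
      0 ≤ t → γ t ∉ 𝒟.metric.causalFuture 𝒟.timeOrientation (𝒟.embed '' K)) → ¬ BddAbove dom) ∧
      (ContMDiff 𝓘(ℝ, E4) (𝓡 4) ∞ Φ ∧ Topology.IsOpenEmbedding Φ ∧ {x : E4 | 0 < x 0 ∧ x 0 + R <
      E4.spatialNorm x} ⊆ (U : Set E4) ∧ 𝒟.metric.causalFuture 𝒟.timeOrientation (range 𝒟.embed) \
      𝒟.metric.causalFuture 𝒟.timeOrientation (𝒟.embed '' K) ⊆ Φ '' {x : U | 0 ≤ x.1 0 ∧ x.1 0 + R <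
      E4.spatialNorm x.1} ∧ (∀ x : U, 𝒟.timeOrientation.IsFutureDirected (mfderiv 𝓘(ℝ, E4) (𝓡 4) Φ x
      (E4.basisVector 0))) ∧ (∀ x : U, ‖𝒟.toSpacetime.deviation (Minkowski.backgroundOn U) Φ x‖ ≤ C
      * Real.log (2 + E4.spatialNorm x.1) / (1 + E4.spatialNorm x.1)) ∧ (∀ x : U, ∀ v : E4, ‖fderiv
      ℝ (𝒟.toSpacetime.deviationExtend (Minkowski.backgroundOn U) Φ) x.1 v‖ ≤ C * Real.log (2 +
      E4.spatialNorm x.1) / ((1 + E4.spatialNorm x.1) * (1 + |x.1 0 - E4.spatialNorm x.1|)) * ‖v‖))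
      ∧ (∀ K' : Set X, IsCompact K' → ∃ K'' : Set X, IsCompact K'' ∧ ∀ q ∈ 𝒟.metric.causalFuture
      𝒟.timeOrientation (range 𝒟.embed), q ∉ 𝒟.metric.causalFuture 𝒟.timeOrientation (𝒟.embed ''
      K'') → ∃ (p : X) (γ : ℝ → 𝒟.carrier) (dom : Set ℝ) (t : ℝ), 𝒟.metric.IsNormalisedNullRayFrom
      𝒟.timeOrientation 𝒟.embed 𝒟.normal p γ dom ∧ t ∈ dom ∧ 0 ≤ t ∧ γ t = q ∧ ∀ t' ∈ dom, 0 ≤ t' →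
      γ t' ∉ 𝒟.metric.causalFuture 𝒟.timeOrientation (𝒟.embed '' K')) ∧ ∀ K' : Set X, IsCompact K' →
      ∃ Bs : Set X, IsCompact Bs ∧ ∀ B : Set X, IsCompact B → Bs ⊆ B → ∃ R' : ℝ, ∀ t₁ : ℝ, ∃ B₁ :
      Set X, IsCompact B₁ ∧ ∀ p ∉ B₁, ∀ (γ : ℝ → 𝒟.carrier) (dom : Set ℝ),
      𝒟.metric.IsNormalisedNullRayFrom 𝒟.timeOrientation 𝒟.embed 𝒟.normal p γ dom → (∃ t ∈ dom, 0 ≤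
      t ∧ γ t ∈ 𝒟.metric.causalFuture 𝒟.timeOrientation (𝒟.embed '' B)) → ∃ (s₀ : ℝ) (x : U) (w :
      E4), s₀ ∈ dom ∧ 0 ≤ s₀ ∧ γ s₀ ∈ 𝒟.metric.causalFuture 𝒟.timeOrientation (𝒟.embed '' B) ∧ γ s₀
      ∉ 𝒟.metric.causalFuture 𝒟.timeOrientation (𝒟.embed '' K') ∧ γ s₀ = Φ x ∧ t₁ ≤ x.1 0 ∧ x.1 0 +
      R < E4.spatialNorm x.1 ∧ E4.spatialNorm x.1 ≤ x.1 0 + R' ∧ velocity (𝓡 4) γ s₀ = mfderiv 𝓘(ℝ,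
      E4) (𝓡 4) Φ x w ∧ 1 / 2 ≤ w 0 ∧ w 0 ≤ 2) → (∃ (O : Set 𝒟.carrier) (d : FinalStateDecomposition
      𝒟.toSpacetime O 2), (∀ i, Kerr.IsSubextremal (d.mass i) (d.spin i)) ∧ O =
      Summit.FinalStateConjecture.exteriorOf 𝒟.toCauchyDevelopment d.charted ∧
      Summit.FinalStateConjecture.RaysStayInClosure 𝒟.toCauchyDevelopment O ∧
      Summit.FinalStateConjecture.HasExhaustiveCharts d ∧
      Summit.FinalStateConjecture.IsFutureOriented d) →
      Summit.FinalStateConjecture.HasCompleteNullInfinity 𝒟.toCauchyDevelopment) →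
    (∃ k : ℕ, ∀ (X : Type) [TopologicalSpace X] [ChartedSpace E3 X] [IsManifold (𝓡 3) ∞ X] [T2Space
      X] [SecondCountableTopology X] [ConnectedSpace X], ∀ D ∈ admissibleVacuumData X, ∀ 𝒟 :
      VacuumCauchyDevelopment D, 𝒟.IsMaximal → (∃ (O : Set 𝒟.carrier) (N : ℕ) (M a : Fin N → ℝ) (mo
      : Fin N → lorentzGroup × E4) (τ₀ : ℝ) (Ψ : ∀ i, boostedKerrExterior (mo i).1 (mo i).2 (M i) (a
      i) → 𝒟.carrier) (ρ R : Fin N → ℝ → ℝ) (U₀ : Opens E4) (Ψ₀ : U₀ → 𝒟.carrier), (∀ i,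
      Kerr.IsSubextremal (M i) (a i)) ∧ (∀ i, 𝒟.toSpacetime.IsLateChart (boostedKerrBackground (mo
      i).1 (mo i).2 (M i) (a i)) O τ₀ (Ψ i)) ∧ 𝒟.toSpacetime.IsLateChart (Minkowski.backgroundOn U₀)
      O τ₀ Ψ₀ ∧ (∀ i, Tendsto (fun t ↦ ρ i t / t) atTop (𝓝 0)) ∧ (∀ i, Tendsto (R i) atTop atTop ∧ ∀
      τ, max (Kerr.rPlus (M i) (a i)) 0 + 1 ≤ R i τ) ∧ {x : E4 | τ₀ < x 0 ∧ ∀ i, ρ i (x 0) <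
      Kerr.radius (a i) (poincareInv (mo i).1 (mo i).2 x)} ⊆ (U₀ : Set E4) ∧ (∀ R' : ℝ, ∃ τ₁ : ℝ,
      Pairwise (Function.onFun Disjoint fun i ↦ Ψ i '' (boostedKerrBackground (mo i).1 (mo i).2 (M
      i) (a i)).truncLateRegion τ₁ R')) ∧ O = Summit.FinalStateConjecture.exteriorOf
      𝒟.toCauchyDevelopment ((⋃ i, Ψ i '' (boostedKerrBackground (mo i).1 (mo i).2 (M i) (a
      i)).lateRegion τ₀) ∪ Ψ₀ '' (Minkowski.backgroundOn U₀).lateRegion τ₀) ∧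
      Summit.FinalStateConjecture.RaysStayInClosure 𝒟.toCauchyDevelopment O ∧ (∀ τ₁ : ℝ, τ₀ < τ₁ → O
      \ (Ψ₀ '' (Minkowski.backgroundOn U₀).lateRegion τ₁ ∪ ⋃ i, Ψ i '' {x | τ₁ <
      (boostedKerrBackground (mo i).1 (mo i).2 (M i) (a i)).time x.1 ∧ (boostedKerrBackground (mo
      i).1 (mo i).2 (M i) (a i)).radius x.1 ≤ R i ((boostedKerrBackground (mo i).1 (mo i).2 (M i) (a
      i)).time x.1)}) ⊆ 𝒟.metric.causalPast 𝒟.timeOrientation (Ψ₀ '' (Minkowski.backgroundOn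
      U₀).timeSlab τ₁ ∪ ⋃ i, Ψ i '' (boostedKerrBackground (mo i).1 (mo i).2 (M i) (a
      i)).truncTimeSlab (R i τ₁) τ₁)) ∧ ((∀ i, Summit.FinalStateConjecture.IsOrthochronous (mo i).1)
      ∧ ∀ τ : ℝ, τ₀ < τ → ∀ x ∈ (Minkowski.backgroundOn U₀).timeSlab τ,
      𝒟.toSpacetime.timeOrientation.IsFutureDirected (mfderiv 𝓘(ℝ, E4) (𝓡 4) Ψ₀ x (E4.basisVector
      0))) ∧ (∀ τ : ℝ, τ₀ < τ → 𝒟.toSpacetime.deviationCk (Minkowski.backgroundOn U₀) Ψ₀ 0 τ ≤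
      ENNReal.ofReal (1 / 4) ∧ ∀ i, 𝒟.toSpacetime.truncDeviationCk (boostedKerrBackground (mo i).1
      (mo i).2 (M i) (a i)) (Ψ i) 0 (R i τ) τ ≤ ENNReal.ofReal (1 / 4)) ∧ ∀ R' : ℝ, ∀ ε : ℝ, 0 < ε →
      ∃ᶠ τ in atTop, 𝒟.toSpacetime.deviationCk (Minkowski.backgroundOn U₀) Ψ₀ k τ ≤ ENNReal.ofReal ε
      ∧ ∀ i, 𝒟.toSpacetime.truncDeviationCk (boostedKerrBackground (mo i).1 (mo i).2 (M i) (a i)) (Ψ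
      i) k R' τ ≤ ENNReal.ofReal ε ∧ ∀ x ∈ (boostedKerrBackground (mo i).1 (mo i).2 (M i) (a
      i)).truncTimeSlab R' τ, 𝒟.toSpacetime.timeOrientation.IsFutureDirected (mfderiv 𝓘(ℝ, E4) (𝓡 4)
      (Ψ i) x (((mo i).1 : E4 ≃L[ℝ] E4) (Kerr.timeVector (M i) (a i) (poincareInv (mo i).1 (mo i).2
      (x : E4)))))) → ∃ (O : Set 𝒟.carrier) (d : FinalStateDecomposition 𝒟.toSpacetime O 2), (∀ i,
      Kerr.IsSubextremal (d.mass i) (d.spin i)) ∧ O = Summit.FinalStateConjecture.exteriorOf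
      𝒟.toCauchyDevelopment d.charted ∧ Summit.FinalStateConjecture.RaysStayInClosure
      𝒟.toCauchyDevelopment O ∧ Summit.FinalStateConjecture.HasExhaustiveCharts d ∧
      Summit.FinalStateConjecture.IsFutureOriented d) →
    Summit.FinalStateConjecture.FinalStateConjecture.Theses.ClusterCompleteness.LinearToNonlinearCapture :=
  linearToNonlinearCapture_of_subs

/-- **Read-back 1.** The three children give the route TARGET X itself (engine-free). -/
theorem target_of_subs (hfar : FarExteriorControl) (hscri : ScriOfSettledFarControlled)
    (hcap : AnchoredRecurrenceSettles) :
    Summit.FinalStateConjecture.FinalStateConjecture.Theses.ClusterCompleteness.RecurrentMultiKerrCapture := by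
  obtain ⟨k, hk⟩ := hcap
  refine ⟨k, ?_⟩
  intro X _ _ _ _ _ _ D hD 𝒟 hmax hhyp
  have hs := hk X D hD 𝒟 hmax hhyp
  exact ⟨hscri X D hD 𝒟 hmax (hfar X D hD 𝒟 hmax) hs, hs⟩

/-- **Read-back 2 (necessity of C_cap).** The route target implies the capture child. -/
theorem anchoredRecurrenceSettles_of_target
    (h : Summit.FinalStateConjecture.FinalStateConjecture.Theses.ClusterCompleteness.RecurrentMultiKerrCapture) :
    AnchoredRecurrenceSettles := by
  obtain ⟨k, hk⟩ := h
  refine ⟨k, ?_⟩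
  intro X _ _ _ _ _ _ D hD 𝒟 hmax hhyp
  exact (hk X D hD 𝒟 hmax hhyp).2

/-- **Read-back 3.** C_far and C_scri together are the summit-wide statement "every settled maximal
development of admissible data has complete `𝓘⁺`" (recurrence-free, `N`-free, engine-free). -/
theorem scriOfSettled_of_far_of_scri (hfar : FarExteriorControl) (hscri : ScriOfSettledFarControlled) :
    ∀ (X : Type) [TopologicalSpace X] [ChartedSpace E3 X] [IsManifold (𝓡 3) ∞ X] [T2Space X]
      [SecondCountableTopology X] [ConnectedSpace X], ∀ D ∈ admissibleVacuumData X, ∀ 𝒟 :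
      VacuumCauchyDevelopment D, 𝒟.IsMaximal → (∃ (O : Set 𝒟.carrier) (d : FinalStateDecomposition
      𝒟.toSpacetime O 2), (∀ i, Kerr.IsSubextremal (d.mass i) (d.spin i)) ∧ O =
      Summit.FinalStateConjecture.exteriorOf 𝒟.toCauchyDevelopment d.charted ∧
      Summit.FinalStateConjecture.RaysStayInClosure 𝒟.toCauchyDevelopment O ∧
      Summit.FinalStateConjecture.HasExhaustiveCharts d ∧
      Summit.FinalStateConjecture.IsFutureOriented d) →
      Summit.FinalStateConjecture.HasCompleteNullInfinity 𝒟.toCauchyDevelopment :=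
  fun X _ _ _ _ _ _ D hD 𝒟 hmax hs ↦ hscri X D hD 𝒟 hmax (hfar X D hD 𝒟 hmax) hs

/-- **Certificate: C_scri's only open content is the entry-band lemma.** G′ (verbatim the live
line's `stub_entryBandGlue_eventual`) implies `ScriOfSettledFarControlled`, sorry-free: the causal
bookkeeping of the skeleton's derived S_B (REACH via `nullRay_apply_mem_causalFuture` + ESCAPE +
completeness + `RaysStayInClosure`; G′'s later good event; `J⁺ ∘ J⁺ ⊆ J⁺`) read with F″'s
conclusion as a HYPOTHESIS on `𝒟`, followed by the LANDED S_C `Theorems.stub_scriOfEntry`. -/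
theorem scriOfSettledFarControlled_of_entryBandGlue (hG : EntryBandGlueEventual) :
    ScriOfSettledFarControlled := by
  intro X _ _ _ _ _ _ D hD 𝒟 hmax hF hsettles
  -- far completeness (projection of F″'s conclusion)
  have hfar : ∀ [𝒟.metric.HasLeviCivita], ∃ K : Set X, IsCompact K ∧ ∀ (p : X) (γ : ℝ → 𝒟.carrier)
      (dom : Set ℝ), 𝒟.metric.IsNormalisedNullRayFrom 𝒟.timeOrientation 𝒟.embed 𝒟.normal p γ dom →
      (∀ t ∈ dom, 0 ≤ t → γ t ∉ 𝒟.metric.causalFuture 𝒟.timeOrientation (𝒟.embed '' K)) →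
      ¬ BddAbove dom := by
    intro _
    obtain ⟨K, -, -, -, -, hK, hcomplete, -⟩ := hF
    exact ⟨K, hK, hcomplete⟩
  -- entry events (the skeleton's S_B derivation, with F″ as a hypothesis)
  have hent : ∀ [𝒟.metric.HasLeviCivita], ∀ Bₑ : Set X,
      IsCompact Bₑ → ∃ B₀ : Set X, IsCompact B₀ ∧ Bₑ ⊆ B₀ ∧ ∃ (O'' : Set 𝒟.carrier) (d :
      FinalStateDecomposition 𝒟.toSpacetime O'' 2) (L : ℝ), 0 < L ∧ ∀ τ T : ℝ, ∃ B₁ : Set X,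
      IsCompact B₁ ∧ ∀ p ∉ B₁, ∀ (γ : ℝ → 𝒟.carrier) (dom : Set ℝ), 𝒟.metric.IsNormalisedNullRayFrom
      𝒟.timeOrientation 𝒟.embed 𝒟.normal p γ dom → (∃ t ∈ dom, 0 ≤ t ∧ γ t ∈ 𝒟.metric.causalFuture
      𝒟.timeOrientation (𝒟.embed '' B₀)) → ¬ BddAbove dom ∨ ∃ (s₀ : ℝ) (y : d.flatDomain) (w : E4),
      s₀ ∈ dom ∧ 0 ≤ s₀ ∧ γ s₀ ∈ 𝒟.metric.causalFuture 𝒟.timeOrientation (𝒟.embed '' B₀) ∧ γ s₀ =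
      d.flatChart y ∧ d.τ₀ < y.1 0 ∧ τ ≤ y.1 0 ∧ velocity (𝓡 4) γ s₀ = mfderiv 𝓘(ℝ, E4) (𝓡 4)
      d.flatChart y w ∧ 0 < w 0 ∧ w 0 ≤ L ∧ {z : E4 | y.1 0 ≤ z 0 ∧ z 0 ≤ y.1 0 + T ∧ ‖E4.spatial z
      - E4.spatial y.1‖ ≤ 2 * (z 0 - y.1 0) + 1} ⊆ (d.flatDomain : Set E4) := by
    intro _ Bₑ hBₑ
    obtain ⟨Kh, hKh, hcomplete⟩ := hfar
    obtain ⟨O, d, -, hO, hRSIC, hexh, hfo⟩ := hsettles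
    obtain ⟨Kf, R, C, U, Φ, -, -, ⟨h1, h2, h3, h4, h5, h6, h7⟩, hesc, hent⟩ := hF
    obtain ⟨K'', hK'', hescape⟩ := hesc Kh hKh
    obtain ⟨Bs, hBs, hentry⟩ := hent K'' hK''
    -- the far chart block in G′'s operator-norm form, at the constant `max C 0`
    -- (`C * a / b` parses as `(C * a) / b`)
    have ha : ∀ y : E4, 0 ≤ Real.log (2 + E4.spatialNorm y) := fun y ↦
      Real.log_nonneg (by have := E4.spatialNorm_nonneg y; linarith)
    have hb₀ : ∀ y : E4, 0 ≤ 1 + E4.spatialNorm y := fun y ↦ by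
      have := E4.spatialNorm_nonneg y; linarith
    have hb₁ : ∀ y : E4, 0 ≤ (1 + E4.spatialNorm y) * (1 + |y 0 - E4.spatialNorm y|) := fun y ↦
      mul_nonneg (hb₀ y) (by positivity)
    have hC : C ≤ max C 0 := le_max_left C 0
    obtain ⟨O', d', L, hL, hglue⟩ := hG X D hD 𝒟 hmax O d hO hexh hfo Kf R (max C 0) U Φ
      ⟨h1, h2, h3, h4, h5,
        fun x ↦ (h6 x).trans
          (div_le_div_of_nonneg_right (mul_le_mul_of_nonneg_right hC (ha x.1)) (hb₀ x.1)),
        fun x ↦ ContinuousLinearMap.opNorm_le_bound _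
          (div_nonneg (mul_nonneg (le_max_right C 0) (ha x.1)) (hb₁ x.1)) fun v ↦ (h7 x v).trans
            (mul_le_mul_of_nonneg_right
              (div_le_div_of_nonneg_right (mul_le_mul_of_nonneg_right hC (ha x.1)) (hb₁ x.1))
              (norm_nonneg v))⟩
    obtain ⟨R', hR'⟩ := hentry (Bₑ ∪ Bs) (hBₑ.union hBs) subset_union_right
    refine ⟨Bₑ ∪ Bs, hBₑ.union hBs, subset_union_left, O', d', L, hL, fun τ T ↦ ?_⟩
    obtain ⟨t₁, ht₁⟩ := hglue R' τ T
    obtain ⟨B₁, hB₁, hray⟩ := hR' t₁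
    refine ⟨B₁, hB₁, fun p hp γ dom hγ hin ↦ ?_⟩
    obtain ⟨s₀, x, w, hs₀dom, hs₀, hJB, hJK, hγx, hxt, hxR, hxR', hvel, -, hw2⟩ :=
      hray p hp γ dom hγ hin
    have hJrange : γ s₀ ∈ 𝒟.metric.causalFuture 𝒟.timeOrientation (range 𝒟.embed) := by
      have h := nullRay_apply_mem_causalFuture 𝒟.toSpacetime hγ.1 hγ.2.1 hγ.2.2.2.1
        hγ.2.2.2.2.1 hγ.2.1 hs₀dom hs₀
      rw [hγ.2.2.1] at h
      exact LorentzianMetric.causalFuture_mono (singleton_subset_iff.2 (mem_range_self p)) h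
    obtain ⟨p', γ', dom', t', hγ', ht'dom, ht', hγ't', havoid⟩ := hescape (γ s₀) hJrange hJK
    have hcl : Φ x ∈ closure O := by
      rw [← hγx, ← hγ't']
      exact hRSIC p' γ' dom' hγ' (hcomplete p' γ' dom' hγ' havoid) t' ht'dom ht'
    rcases ht₁ p γ dom s₀ x w hγ hs₀dom hs₀ hγx hxt hxR hxR' hcl hvel hw2 with hc |
        ⟨s, y, w', hsdom, hs₀s, hJs, hγy, hτ₀, hτy, hcone, hvel', hw'0, hw'L⟩
    · exact Or.inl hc
    · refine Or.inr ⟨s, y, w', hsdom, hs₀.trans hs₀s, ?_, hγy, hτ₀, hτy, hvel', hw'0, hw'L, hcone⟩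
      exact Spacetime.causalFuture_causalFuture_subset 𝒟.toSpacetime _
        (LorentzianMetric.causalFuture_mono (singleton_subset_iff.2 hJB) hJs)
  exact @Summit.FinalStateConjecture.FinalStateConjecture.Theorems.stub_scriOfEntry X _ _ _ _ _ _ D hD
    𝒟 hmax hfar hent

end Summit.FinalStateConjecture.FinalStateConjecture.Cruxes.LinearToNonlinearCapture.SplitV4
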